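import Summits.Parity.BatemanHorn.Theorems.RoughValueTransportRoughValueLawRieszSingularSeriesOfFactorisation
import Summits.Parity.BatemanHorn.Theorems.RoughValueTransportRoughValueLawSingularSeriesFactorisation
import HarnessLib

/-!
# Crux `RoughValueLaw` (stmt-Parity-11390), line `friable-deep-tail`: stub S2b₂ `stub_rieszSingularSeries`

The registered v6 stub S2b₂ of line `friable-deep-tail` — convergence of the order-`k` Riesz mean of
the truncated singular series of a Bateman–Horn system,

  `Σ_{d₁⋯d_k ≤ D} (∏ᵢ μ(dᵢ)) · ρ_f(d)/∏dᵢ · log^k(D/∏dᵢ) → M`   (`D → ∞`),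

`ρ_f(d) = #{r mod ∏dᵢ : dᵢ ∣ fᵢ(r) ∀ i}` — is now UNCONDITIONAL: the factorisation stub (β)
`stub_singularSeriesFactorisation` (p105661) feeds the composition
`rieszSingularSeries_of_singularSeriesFactorisation` (p101629, itself built on (α)
`stub_rieszProductLimit`, p99246).  This file lands the registered signature VERBATIM (it carries a
redundant hypothesis `2 ≤ k`; the result holds for every `k`, see `rieszSingularSeries`).

References: E. Landau, *Handbuch* §§160–161 (Riesz means); P. T. Bateman, R. A. Horn, Math. Comp. 16
(1962), §2 (the singular series).
-/

noncomputable section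

open Filter Finset Polynomial Real
open scoped Topology BigOperators ArithmeticFunction
open Literature.NumberTheory.Sieve

namespace Summit.Parity.BatemanHorn.Cruxes.RoughValueLaw.FriableDeepTail

/-- **Riesz mean of the truncated singular series, every `k` (unconditional).**  For every
Bateman–Horn system `f` of `k` polynomials the order-`k` Riesz mean
`Σ_{∏dᵢ ≤ D} (∏ᵢ μ(dᵢ)) ρ_f(d)/(∏dᵢ) · log^k(D/∏dᵢ)` converges as `D → ∞`. [folklore] -/
theorem rieszSingularSeries (k : ℕ) (f : Fin k → ℤ[X]) (hf : IsBatemanHornSystem f) :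
    ∃ M : ℝ, Tendsto (fun D : ℕ =>
      ∑ d ∈ (Fintype.piFinset fun _ : Fin k => Icc 1 D) with (∏ i, d i) ≤ D,
        (∏ i, (ArithmeticFunction.moebius (d i) : ℝ)) *
            ((#((range (∏ i, d i)).filter
                (fun r : ℕ => ∀ i, ((d i : ℕ) : ℤ) ∣ (f i).eval (r : ℤ))) : ℕ) : ℝ) /
            (∏ i, ((d i : ℕ) : ℝ)) *
          Real.log ((D : ℝ) / ((∏ i, d i : ℕ) : ℝ)) ^ k) atTop (𝓝 M) :=
  rieszSingularSeries_of_singularSeriesFactorisation stub_singularSeriesFactorisation k f hf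

/-- **Registered stub S2b₂ `stub_rieszSingularSeries` of line `friable-deep-tail` (v6), verbatim**
(the hypothesis `2 ≤ k` is not needed: `rieszSingularSeries`). [folklore] -/
theorem stub_rieszSingularSeries :
    ∀ (k : ℕ) (f : Fin k → ℤ[X]), IsBatemanHornSystem f → 2 ≤ k →
      ∃ M : ℝ, Tendsto (fun D : ℕ =>
        ∑ d ∈ (Fintype.piFinset fun _ : Fin k => Icc 1 D) with (∏ i, d i) ≤ D,
          (∏ i, (ArithmeticFunction.moebius (d i) : ℝ)) *
              ((#((range (∏ i, d i)).filter
                  (fun r : ℕ => ∀ i, ((d i : ℕ) : ℤ) ∣ (f i).eval (r : ℤ))) : ℕ) : ℝ) /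
              (∏ i, ((d i : ℕ) : ℝ)) *
            Real.log ((D : ℝ) / ((∏ i, d i : ℕ) : ℝ)) ^ k) atTop (𝓝 M) :=
  fun k f hf _ => rieszSingularSeries k f hf

end Summit.Parity.BatemanHorn.Cruxes.RoughValueLaw.FriableDeepTail

end
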